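import Literature.Computability.Cryptography.ChenQuantumLWEReadoutClass

/-!
# Chen 2024 (withdrawn), Step 8 → Step 9: SEVERAL COPIES — companion runs sharing the slopes do not help

REPRODUCTION / ANALYSIS OF A CLAIMED RESULT UNDER ADJUDICATION — header required by the tree's literature
rule.  Author: Yilei Chen.  Title: *Quantum Algorithms for Lattice Problems*.  Venue: IACR Cryptology ePrint
Archive, Paper 2024/555, version of 18 April 2024 (the main claim WITHDRAWN by the author, title-page note;
the bug is in Step 9, p. 37). [ChenQuantumLattice2024]  Printed page numbers.

HONEST FRAMING (bundle `papers/QuantumAdvantage/lwe-quantum-autopsy/`, Part 1, generation 13): the value of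
this file is a kernel-checked THEOREM — a precise NEGATIVE result: the exact minimax value of one read-out
problem about one step of a withdrawn algorithm does not improve with any number of further copies of the
register — NOT summit progress and no cryptanalytic claim in either direction (nothing here says LWE is
quantumly easy or hard; no algorithm for LWE is proposed, repaired or broken; the §3.5.9 bug stands).

THE QUESTION ((σ″) of the bundle's HANDOFF, "several copies").  (S) `Shape.step9Needs_readout_le_dummies` and
(U) `Shape.step9Needs_readout_value_class` decide the SINGLE-COPY problem: over all general measurements of the
Step-8 register `|φ7.d⟩` and all decoders, against all instances of the class `InClass U` (slopes `b_i`,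
`i ∈ U`, and the offset unknown), the minimax weight of reading the Step-9 datum `v′₀ mod D²P` is
`pairsCountT(Q,T_U)/Q^{2n}·⟨φ7.d|φ7.d⟩`, `T_U = {t : t+1 ∈ U}`.  The obstruction is that the unknown slopes
`b_T` act as dummies.  Chen's algorithm is RUN MANY TIMES on the same secret: does a JOINT measurement of the
reference register together with `r` companion registers of further runs — which SHARE the slope vector `b`
(the secret) but carry their own, independent unknown offsets — read the reference datum any better, and how
does the value decay in `r`?

THE ANSWER (this file): NOT AT ALL — the value is `pairsCountT(Q,T_U)/Q^{2n}` for EVERY `r`.  The mechanism is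
SLOPE BLINDNESS: for every base offset `w ∈ Dℤⁿ⁺¹`, the operator `Σ_{x,ȳ} |φ7.d(b′, w + L·(x,ȳ))⟩⟨φ7.d(b′, w + L·(x,ȳ))|`
(the register of a run averaged over that run's own unknown offset) equals `Q⁻ⁿ Σ_{η,m} |T w_{η,m}⟩⟨T w_{η,m}|`
and so DOES NOT DEPEND ON THE SLOPES `b′` ((R)'s Fourier sandwich, here for an arbitrary matrix, plus the
bijection `x ↦ −2(x + σ_{b′}(η))` of `ℤ_Q`, `Q` odd): a run whose offset is unknown carries no information about
the slopes, hence none about the dummies that obstruct the reference read-out.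

WHAT IS DONE HERE.  Fix an admissible shape `S`.
* Abstract layer (any finite register `X` with an environment `Y`): **`tensorKet`**, **`embedMat`** /
  **`compress`** (`V_Φᴴ M V_Φ`, `V_Φ : |x⟩ ↦ |x⟩ ⊗ Φ`), **`POVM.envAverage`** — a joint POVM on `X × Y` and a
  family of environment states `Φ_t` of equal norm give the EFFECTIVE POVM `(#τ·ν)⁻¹ Σ_t V_{Φ_t}ᴴ E_a V_{Φ_t}`
  on `X` whose weights are the averaged joint weights (**`envAverage_weight`**); **`POVM.sum_weight_tensorKet_eq_of_gram_eq`**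
  — summed joint weights depend on the environment family only through its Gram kernel; **`POVM.tensorOne`**
  (`E ⊗ 1`, **`tensorOne_weight`**); **`piKet`**, **`gram_piKet`** (product families have product Gram kernels).
* **`Shape.sum_sandwich_fam_eq`**, **`Shape.sum_sandwich_family_eq`**, **`Shape.gram_famKet_eq`**,
  **`Shape.gram_famKet_slope_free`** — the Fourier sandwich of (R) `sum_weight_fam_eq` for an arbitrary matrix,
  summed over the head offset too, and its Gram form: SLOPE BLINDNESS of the `(x,ȳ)`-family.
* **`Shape.compOffset`**, **`Shape.compFam`**, **`Shape.compKet`** — the companion register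
  `⊗_k |φ7.d(b′, w_k + L·t_k)⟩` of `r = #κ` further runs (base offsets `w_k ∈ Dℤⁿ⁺¹`, family parameters
  `t_k ∈ ℤ_Q × ℤ_Qⁿ`, shared slopes `b′`); **`Shape.compOffset_admissible`** (companions are instances of the
  class), **`Shape.star_compKet_dotProduct_compKet`** (norm `ν₇^r`), **`Shape.gram_compKet_slope_free`**
  (the companion register, averaged over `t`, is the same state for all admissible slopes).
* **`Shape.step9Needs_readout_le_joint`** — UPPER SIDE: for EVERY joint POVM on reference × companions and
  EVERY decoder there are an instance `(b₂,v₂) ∈ InClass U` and companion parameters `t` (all companions in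
  `InClass U` with the same slopes `b₂`) with success weight `≤ pairsCountT(Q,T)/Q^{2n}·⟨Ψ|Ψ⟩` (`T+1 ⊆ U`):
  average the companions out (reference slopes `b`), apply (S) to the effective POVM, transfer to slopes `b₂`
  by blindness, and pick a companion tuple no better than the average.
* **`Shape.step9Needs_readout_attained_joint`** — LOWER SIDE: (U)'s class measurement on the reference
  register, extended trivially (`classPOVM ⊗ 1`), attains the constant on every instance, whatever the
  environment state; **`Shape.step9Needs_readout_value_joint`** packages both sides at `T = T_U`.

SCOPE (honest).  (a) Decided: for every number `r` of companion copies the minimax value (over joint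
measurements and decoders, against instances of `InClass U` and companion family parameters) of reading the
REFERENCE run's Step-9 datum is `pairsCountT(Q,T_U)/Q^{2n}`, the single-copy value of (U) — no decay in `r`.
Reading out the whole tuple of the runs' data is only harder (not formalised; immediate).  (b) Modelling: the
companions' unknown offsets are members `w_k + L·(x_k,ȳ_k)` of the same `(x,ȳ)`-families that (R)/(S) use for
the reference run, over arbitrary base offsets `w_k ∈ Dℤⁿ⁺¹`, and the companions share the reference run's
slope vector exactly (same secret); side information correlating a companion's offset with anything else is
outside the model, and then nothing here applies.  (c) `envAverage`, `tensorOne`, `classPOVM` are mathematical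
POVMs on the registers of eq. (35)/§3.5.8 as formalised in `ChenQuantumLWESteps` / `ChenQuantumLWEStepEight`;
no circuit or complexity statement is made or needed.  (d) Nothing here bears on LWE: Step 9 as printed needs
the datum with certainty, one copy gives `≈ 1/Q + 1/Q^{#T_U}` at best and further copies give nothing more;
Part 1 (A)–(D) and the paper's own bug note (p. 37) stand; no repair and no attack is suggested.  (e) No
numerics enter any proof; for composite odd `Q` the integer `pairsCountT` is not evaluated in closed form.

Everything is `sorry`-free over Mathlib and modules (A)–(U) of the bundle (imported, nothing re-proved).
-/

namespace Literature.Computability.Cryptography.Chen2024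

open Matrix ComplexOrder
open scoped Kronecker

/-! ### Abstract layer: a register `X` measured JOINTLY with an environment `Y` in a known pure state -/

section Joint

variable {X Y : Type*} [Fintype X] [Fintype Y]

/-- The product ket `ψ ⊗ Φ` on `X × Y`. [cite: NielsenChuang2010, §2.1.7 p. 73] -/
def tensorKet (ψ : X → ℂ) (Φ : Y → ℂ) : X × Y → ℂ := fun p => ψ p.1 * Φ p.2

/-- `⟨ψ ⊗ Φ|ψ′ ⊗ Φ′⟩ = ⟨ψ|ψ′⟩·⟨Φ|Φ′⟩`. [cite: NielsenChuang2010, §2.1.7 p. 73] -/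
theorem star_tensorKet_dotProduct_tensorKet (ψ ψ' : X → ℂ) (Φ Φ' : Y → ℂ) :
    star (tensorKet ψ Φ) ⬝ᵥ tensorKet ψ' Φ' = (star ψ ⬝ᵥ ψ') * (star Φ ⬝ᵥ Φ') := by
  simp only [dotProduct, Pi.star_apply, tensorKet, Fintype.sum_prod_type, star_mul', Finset.sum_mul_sum]
  exact Finset.sum_congr rfl fun x _ => Finset.sum_congr rfl fun y _ => by ring

/-- The embedding `V_Φ : |x⟩ ↦ |x⟩ ⊗ Φ` as an `(X × Y) × X` matrix. [cite: NielsenChuang2010, §2.1.7 p. 73] -/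
def embedMat [DecidableEq X] (Φ : Y → ℂ) : Matrix (X × Y) X ℂ :=
  Matrix.of fun p x => if p.1 = x then Φ p.2 else 0

variable [DecidableEq X]

omit [Fintype X] [Fintype Y] in
/-- Entries of `V_Φ`. [cite: NielsenChuang2010, §2.1.7 p. 73] -/
theorem embedMat_apply (Φ : Y → ℂ) (p : X × Y) (x : X) :
    embedMat Φ p x = if p.1 = x then Φ p.2 else 0 := rfl

omit [Fintype X] [Fintype Y] in
/-- Entries of `V_Φᴴ`. [cite: NielsenChuang2010, §2.1.7 p. 73] -/
theorem conjTranspose_embedMat_apply (Φ : Y → ℂ) (x : X) (p : X × Y) :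
    (embedMat Φ)ᴴ x p = if p.1 = x then star (Φ p.2) else 0 := by
  rw [conjTranspose_apply, embedMat_apply]
  split_ifs <;> simp

omit [Fintype Y] in
/-- `V_Φ ψ = ψ ⊗ Φ`. [cite: NielsenChuang2010, §2.1.7 p. 73] -/
theorem embedMat_mulVec (Φ : Y → ℂ) (ψ : X → ℂ) : embedMat Φ *ᵥ ψ = tensorKet ψ Φ := by
  funext p
  simp only [mulVec, dotProduct, embedMat_apply, tensorKet, ite_mul, zero_mul, Finset.sum_ite_eq,
    Finset.mem_univ, if_true]
  ring

/-- `V_Φᴴ V_Φ = ⟨Φ|Φ⟩·1`. [cite: NielsenChuang2010, §2.1.7 p. 73] -/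
theorem conjTranspose_embedMat_mul_self (Φ : Y → ℂ) :
    (embedMat Φ)ᴴ * embedMat Φ = (star Φ ⬝ᵥ Φ) • (1 : Matrix X X ℂ) := by
  ext x x'
  rw [Matrix.mul_apply, Matrix.smul_apply, Matrix.one_apply, Fintype.sum_prod_type, Finset.sum_comm]
  simp only [conjTranspose_embedMat_apply, embedMat_apply, ite_mul, zero_mul, mul_ite, mul_zero,
    Finset.sum_ite_eq', Finset.mem_univ, if_true]
  by_cases h : x = x'
  · subst h
    simp [dotProduct]
  · simp [h, Ne.symm h]

/-- COMPRESSION of a joint operator `M` on `X × Y` against the environment state `Φ`: `V_Φᴴ M V_Φ`, an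
operator on `X`. [cite: NielsenChuang2010, §2.4.3 p. 107] -/
def compress (M : Matrix (X × Y) (X × Y) ℂ) (Φ : Y → ℂ) : Matrix X X ℂ := (embedMat Φ)ᴴ * M * embedMat Φ

/-- Compressions of positive operators are positive. [cite: NielsenChuang2010, §2.4.3 p. 107] -/
theorem compress_posSemidef {M : Matrix (X × Y) (X × Y) ℂ} (hM : M.PosSemidef) (Φ : Y → ℂ) :
    (compress M Φ).PosSemidef :=
  hM.conjTranspose_mul_mul_same _

/-- **`⟨ψ ⊗ Φ| M |ψ ⊗ Φ⟩ = ⟨ψ| V_Φᴴ M V_Φ |ψ⟩`.** [cite: NielsenChuang2010, §2.4.3 p. 107] -/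
theorem star_tensorKet_dotProduct_mulVec (M : Matrix (X × Y) (X × Y) ℂ) (ψ : X → ℂ) (Φ : Y → ℂ) :
    star (tensorKet ψ Φ) ⬝ᵥ (M *ᵥ tensorKet ψ Φ) = star ψ ⬝ᵥ (compress M Φ *ᵥ ψ) := by
  rw [← embedMat_mulVec]
  simp only [compress, star_mulVec, dotProduct_mulVec, vecMul_vecMul]

/-- Compression is additive in the operator. [cite: NielsenChuang2010, §2.4.3 p. 107] -/
theorem compress_sum {ι : Type*} (s : Finset ι) (M : ι → Matrix (X × Y) (X × Y) ℂ) (Φ : Y → ℂ) :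
    compress (∑ i ∈ s, M i) Φ = ∑ i ∈ s, compress (M i) Φ := by
  simp only [compress, Matrix.mul_sum, Matrix.sum_mul]

variable [DecidableEq Y]

/-- `V_Φᴴ 1 V_Φ = ⟨Φ|Φ⟩·1`. [cite: NielsenChuang2010, §2.4.3 p. 107] -/
theorem compress_one (Φ : Y → ℂ) : compress (1 : Matrix (X × Y) (X × Y) ℂ) Φ = (star Φ ⬝ᵥ Φ) • 1 := by
  rw [compress, Matrix.mul_one, conjTranspose_embedMat_mul_self]

variable {A : Type*} [Fintype A]

namespace POVM

/-- **THE EFFECTIVE MEASUREMENT ON `X`** of a joint POVM `E` on `X × Y` when the environment `Y` is prepared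
in a uniformly random member of a nonempty finite family `Φ_t` (`t ∈ τ`) of kets of common squared norm
`ν > 0`: `E″_a := (#τ·ν)⁻¹·Σ_t V_{Φ_t}ᴴ E_a V_{Φ_t}`. [cite: NielsenChuang2010, §2.4.3 p. 107, §2.2.6 p. 90] -/
noncomputable def envAverage (E : POVM (X × Y) A) {τ : Type*} [Fintype τ] [Nonempty τ] (Φ : τ → Y → ℂ)
    (ν : ℝ) (hν : 0 < ν) (hΦ : ∀ t, star (Φ t) ⬝ᵥ Φ t = (ν : ℂ)) : POVM X A where
  effect a := ((((Fintype.card τ : ℝ) * ν)⁻¹ : ℝ) : ℂ) • ∑ t, compress (E.effect a) (Φ t)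
  posSemidef a := (posSemidef_sum _ fun t _ => compress_posSemidef (E.posSemidef a) (Φ t)).smul
    (Complex.zero_le_real.2 (inv_nonneg.2 (mul_nonneg (Nat.cast_nonneg _) hν.le)))
  sum_eq_one := by
    rw [← Finset.smul_sum, Finset.sum_comm]
    have h1 : ∀ t, ∑ a, compress (E.effect a) (Φ t) = ((ν : ℝ) : ℂ) • (1 : Matrix X X ℂ) := fun t => by
      rw [← compress_sum, E.sum_eq_one, compress_one, hΦ t]
    simp only [h1, Finset.sum_const, Finset.card_univ, ← Nat.cast_smul_eq_nsmul ℂ, smul_smul]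
    have hc : ((((Fintype.card τ : ℝ) * ν)⁻¹ : ℝ) : ℂ) * ((Fintype.card τ : ℂ) * ((ν : ℝ) : ℂ)) = 1 := by
      have hτ : (Fintype.card τ : ℝ) ≠ 0 := by exact_mod_cast Fintype.card_ne_zero
      have : ((Fintype.card τ : ℂ)) = ((Fintype.card τ : ℝ) : ℂ) := by push_cast; rfl
      rw [this, ← Complex.ofReal_mul, ← Complex.ofReal_mul, ← Complex.ofReal_one]
      congr 1
      exact inv_mul_cancel₀ (mul_ne_zero hτ hν.ne')
    rw [hc, one_smul]

/-- **Weights of the effective measurement** are the averaged joint weights: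
`⟨ψ|E″_a|ψ⟩ = (#τ·ν)⁻¹·Σ_t ⟨ψ ⊗ Φ_t|E_a|ψ ⊗ Φ_t⟩`. [cite: NielsenChuang2010, §2.4.3 p. 107, §2.2.6 p. 90] -/
theorem envAverage_weight (E : POVM (X × Y) A) {τ : Type*} [Fintype τ] [Nonempty τ] (Φ : τ → Y → ℂ)
    (ν : ℝ) (hν : 0 < ν) (hΦ : ∀ t, star (Φ t) ⬝ᵥ Φ t = (ν : ℂ)) (ψ : X → ℂ) (a : A) :
    (E.envAverage Φ ν hν hΦ).weight ψ a
      = ((((Fintype.card τ : ℝ) * ν)⁻¹ : ℝ) : ℂ) * ∑ t, E.weight (tensorKet ψ (Φ t)) a := by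
  show star ψ ⬝ᵥ ((((((Fintype.card τ : ℝ) * ν)⁻¹ : ℝ) : ℂ) • ∑ t, compress (E.effect a) (Φ t)) *ᵥ ψ) = _
  rw [smul_mulVec, dotProduct_smul, smul_eq_mul, sum_mulVec, dotProduct_sum]
  congr 1
  exact Finset.sum_congr rfl fun t _ => (star_tensorKet_dotProduct_mulVec _ _ _).symm

/-- Real form of `envAverage_weight`, summed over a set of outcomes. [cite: NielsenChuang2010, §2.2.6 p. 90] -/
theorem sum_envAverage_weight_re (E : POVM (X × Y) A) {τ : Type*} [Fintype τ] [Nonempty τ] (Φ : τ → Y → ℂ)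
    (ν : ℝ) (hν : 0 < ν) (hΦ : ∀ t, star (Φ t) ⬝ᵥ Φ t = (ν : ℂ)) (ψ : X → ℂ) (F : Finset A) :
    ∑ a ∈ F, ((E.envAverage Φ ν hν hΦ).weight ψ a).re
      = ((Fintype.card τ : ℝ) * ν)⁻¹ * ∑ t, ∑ a ∈ F, (E.weight (tensorKet ψ (Φ t)) a).re := by
  rw [Finset.sum_comm, Finset.mul_sum]
  refine Finset.sum_congr rfl fun a _ => ?_
  rw [envAverage_weight, Complex.re_ofReal_mul, Complex.re_sum]

/-- **Joint weights of product states depend on the environment family only through its Gram kernel**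
`K(y,y′) = Σ_t conj(Φ_t(y))·Φ_t(y′)`: `Σ_t ⟨ψ ⊗ Φ_t|E_a|ψ ⊗ Φ_t⟩ = Σ_{p,q} conj(ψ_{p₁})ψ_{q₁}(E_a)_{pq}K(p₂,q₂)`.
[cite: NielsenChuang2010, §2.4.3 p. 107] -/
theorem sum_weight_tensorKet_eq (E : POVM (X × Y) A) {σ : Type*} [Fintype σ] (Ψ : σ → Y → ℂ)
    (ψ : X → ℂ) (a : A) :
    ∑ t, E.weight (tensorKet ψ (Ψ t)) a
      = ∑ p : X × Y, ∑ q : X × Y, star (ψ p.1) * ψ q.1 * E.effect a p q * ∑ t, star (Ψ t p.2) * Ψ t q.2 := by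
  simp only [POVM.weight, dotProduct, mulVec, tensorKet, Pi.star_apply, star_mul', Finset.mul_sum]
  rw [Finset.sum_comm]
  refine Finset.sum_congr rfl fun p _ => ?_
  rw [Finset.sum_comm]
  exact Finset.sum_congr rfl fun q _ => Finset.sum_congr rfl fun t _ => by ring

/-- Hence two environment families with the same Gram kernel give the same summed joint weights
`Σ_t ⟨ψ ⊗ Φ_t|E_a|ψ ⊗ Φ_t⟩` for every `ψ` and `a`. [cite: NielsenChuang2010, §2.4.3 p. 107] -/
theorem sum_weight_tensorKet_eq_of_gram_eq (E : POVM (X × Y) A) {τ τ' : Type*} [Fintype τ] [Fintype τ']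
    (Φ : τ → Y → ℂ) (Φ' : τ' → Y → ℂ)
    (hG : ∀ y y', ∑ t, star (Φ t y) * Φ t y' = ∑ t, star (Φ' t y) * Φ' t y') (ψ : X → ℂ) (a : A) :
    ∑ t, E.weight (tensorKet ψ (Φ t)) a = ∑ t, E.weight (tensorKet ψ (Φ' t)) a := by
  rw [E.sum_weight_tensorKet_eq Φ, E.sum_weight_tensorKet_eq Φ']
  simp only [hG]

/-- **THE TRIVIAL EXTENSION `E ⊗ 1`** of a measurement of `X` to `X × Y` (measure `X`, ignore `Y`).
[cite: NielsenChuang2010, §2.2.6 p. 90, §2.1.7 p. 74] -/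
noncomputable def tensorOne (E : POVM X A) (Y : Type*) [Fintype Y] [DecidableEq Y] : POVM (X × Y) A where
  effect a := E.effect a ⊗ₖ (1 : Matrix Y Y ℂ)
  posSemidef a := (E.posSemidef a).kronecker Matrix.PosSemidef.one
  sum_eq_one := by
    have : ∑ a, E.effect a ⊗ₖ (1 : Matrix Y Y ℂ) = (∑ a, E.effect a) ⊗ₖ (1 : Matrix Y Y ℂ) := by
      ext ⟨x, y⟩ ⟨x', y'⟩
      simp only [Matrix.sum_apply, Matrix.kronecker_apply, Finset.sum_mul]
    rw [this, E.sum_eq_one, Matrix.one_kronecker_one]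

omit [DecidableEq X] in
/-- `(M ⊗ 1)(ψ ⊗ Φ) = (Mψ) ⊗ Φ`. [cite: NielsenChuang2010, §2.1.7 p. 74] -/
theorem kronecker_one_mulVec_tensorKet (M : Matrix X X ℂ) (ψ : X → ℂ) (Φ : Y → ℂ) :
    (M ⊗ₖ (1 : Matrix Y Y ℂ)) *ᵥ tensorKet ψ Φ = tensorKet (M *ᵥ ψ) Φ := by
  funext p
  obtain ⟨x, y⟩ := p
  simp only [mulVec, dotProduct, tensorKet, Fintype.sum_prod_type, Matrix.kronecker_apply, Matrix.one_apply,
    mul_ite, mul_one, mul_zero, ite_mul, zero_mul, Finset.sum_ite_eq, Finset.mem_univ, if_true,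
    Finset.sum_mul]
  exact Finset.sum_congr rfl fun x' _ => by ring

/-- `⟨ψ ⊗ Φ|(E_a ⊗ 1)|ψ ⊗ Φ⟩ = ⟨ψ|E_a|ψ⟩·⟨Φ|Φ⟩`. [cite: NielsenChuang2010, §2.2.6 p. 90, §2.1.7 p. 74] -/
theorem tensorOne_weight (E : POVM X A) (ψ : X → ℂ) (Φ : Y → ℂ) (a : A) :
    (E.tensorOne Y).weight (tensorKet ψ Φ) a = E.weight ψ a * (star Φ ⬝ᵥ Φ) := by
  show star (tensorKet ψ Φ) ⬝ᵥ ((E.effect a ⊗ₖ (1 : Matrix Y Y ℂ)) *ᵥ tensorKet ψ Φ) = _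
  rw [kronecker_one_mulVec_tensorKet, star_tensorKet_dotProduct_tensorKet]
  rfl

end POVM

omit [Fintype X] [DecidableEq X] in
/-- The PRODUCT KET `⊗_k f_k` of a finite family of kets on `X`, a ket on `κ → X`.
[cite: NielsenChuang2010, §2.1.7 p. 73] -/
def piKet {κ : Type*} [Fintype κ] (f : κ → X → ℂ) : (κ → X) → ℂ := fun y => ∏ k, f k (y k)

omit [DecidableEq X] in
/-- `⟨⊗_k f_k|⊗_k g_k⟩ = Π_k ⟨f_k|g_k⟩`. [cite: NielsenChuang2010, §2.1.7 p. 73] -/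
theorem star_piKet_dotProduct_piKet {κ : Type*} [Fintype κ] [DecidableEq κ] (f g : κ → X → ℂ) :
    star (piKet f) ⬝ᵥ piKet g = ∏ k, (star (f k) ⬝ᵥ g k) := by
  simp only [dotProduct, Pi.star_apply, piKet]
  rw [Fintype.prod_sum (fun k z => star (f k z) * g k z)]
  refine Finset.sum_congr rfl fun y _ => ?_
  rw [Finset.prod_mul_distrib, star_prod]

omit [Fintype X] [DecidableEq X] in
/-- **The Gram kernel of a product family is the product of the Gram kernels**: for families `f_k : σ → (X → ℂ)`,
`Σ_{t : κ → σ} conj(⊗_k f_k(t_k))(y)·(⊗_k f_k(t_k))(y′) = Π_k Σ_s conj(f_k(s)(y_k))·f_k(s)(y′_k)`.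
[cite: NielsenChuang2010, §2.1.7 p. 73] -/
theorem gram_piKet {κ σ : Type*} [Fintype κ] [DecidableEq κ] [Fintype σ] (f : κ → σ → X → ℂ)
    (y y' : κ → X) :
    ∑ t : κ → σ, star (piKet (fun k => f k (t k)) y) * piKet (fun k => f k (t k)) y'
      = ∏ k, ∑ s, star (f k s (y k)) * f k s (y' k) := by
  rw [Fintype.prod_sum (fun k s => star (f k s (y k)) * f k s (y' k))]
  refine Finset.sum_congr rfl fun t _ => ?_
  simp only [piKet]
  rw [Finset.prod_mul_distrib, star_prod]

end Joint

/-! ### A unimodular scalar and a matrix unit inside a sandwich -/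

/-- A unimodular scalar does not change a sandwich `⟨w|A|w⟩`. [cite: NielsenChuang2010, §2.2.6 p. 90] -/
theorem sandwich_unimodular_mul {X : Type*} [Fintype X] (A : Matrix X X ℂ) {a : ℂ}
    (ha : (starRingEnd ℂ) a * a = 1) (w : X → ℂ) :
    star (fun p => a * w p) ⬝ᵥ (A *ᵥ fun p => a * w p) = star w ⬝ᵥ (A *ᵥ w) := by
  have h1 : (fun p => a * w p) = a • w := by
    funext p
    simp [Pi.smul_apply, smul_eq_mul]
  rw [h1, star_smul, Matrix.mulVec_smul, smul_dotProduct, dotProduct_smul, Complex.star_def, smul_smul,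
    ha, one_smul]

/-- `⟨φ|E_{zz′}|ψ⟩ = conj(φ_z)·ψ_{z′}` for the matrix unit `E_{zz′}`: sandwiches of matrix units are the
entries of the Gram kernel. [folklore] -/
theorem star_dotProduct_single_mulVec {X : Type*} [Fintype X] [DecidableEq X] (φ ψ : X → ℂ) (z z' : X) :
    star φ ⬝ᵥ (Matrix.single z z' (1 : ℂ) *ᵥ ψ) = star (φ z) * ψ z' := by
  rw [Matrix.single_mulVec, one_mul]
  simp [dotProduct, Function.update_apply, Finset.sum_ite_eq']

/-- `⟨Φ|Φ⟩ = Σ_y |Φ_y|²` is real. [folklore] -/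
theorem star_dotProduct_self_ofReal {Y : Type*} [Fintype Y] (Φ : Y → ℂ) :
    star Φ ⬝ᵥ Φ = ((∑ y, Complex.normSq (Φ y) : ℝ) : ℂ) := by
  rw [Complex.ofReal_sum]
  simp only [dotProduct, Pi.star_apply, Complex.normSq_eq_conj_mul_self, Complex.star_def]

/-! ### Chen side: SLOPE BLINDNESS of the class family, and the several-copies read-out value -/

namespace Shape

variable (S : Shape)

/-- `ν₇ = (MD)^{n+1}·P·2ⁿ`, the common squared norm `⟨φ7.d|φ7.d⟩` of the (unnormalised) Step-8 register
state of every admissible instance ((P) `star_phi7d_dotProduct_phi7d_inst`), as a real number.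
[cite: ChenQuantumLattice2024, eq. (35) p. 31, §3.5.8 p. 33] -/
noncomputable def normSq7d : ℝ := (((S.M : ℕ) : ℝ) * (S.D : ℕ)) ^ (S.n + 1) * (((S.P : ℕ) : ℝ) * 2 ^ S.n)

/-- `ν₇ > 0`. [folklore] -/
theorem normSq7d_pos : 0 < S.normSq7d := by
  unfold normSq7d
  positivity

/-- `⟨φ7.d|φ7.d⟩ = ν₇` on every admissible instance (real form of (P) `star_phi7d_dotProduct_phi7d_inst`).
[cite: ChenQuantumLattice2024, eq. (35) p. 31, §3.5.8 p. 33] -/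
theorem star_phi7d_dotProduct_phi7d_inst_ofReal {b v : Fin (S.n + 1) → ℤ} (hI : (S.inst b v).Admissible) :
    star (S.inst b v).phi7d ⬝ᵥ (S.inst b v).phi7d = (S.normSq7d : ℂ) := by
  rw [S.star_phi7d_dotProduct_phi7d_inst hI, normSq7d]
  push_cast
  ring

/-- The `(x, ȳ)`-FAMILY of the class with slope vector `b′`: the Step-8 register state
`|φ7.d(b′, v′ + L·(x, ȳ))⟩` ((R) `inst`/`vOf`/`xyv`), as a ket on `ℤ_M^{n+1}`.
[cite: ChenQuantumLattice2024, eq. (35) p. 31, §3.5.8 p. 33] -/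
noncomputable def famKet (b' : Fin (S.n + 1) → ℤ) (s : ZMod S.Q × (Fin S.n → ZMod S.Q)) :
    (Fin (S.n + 1) → ZMod S.M) → ℂ :=
  (S.inst b' (S.vOf (S.xyv s.1 s.2))).phi7d

/-- Unfolding `famKet`. [cite: ChenQuantumLattice2024, eq. (35) p. 31] -/
theorem famKet_apply (b' : Fin (S.n + 1) → ℤ) (s : ZMod S.Q × (Fin S.n → ZMod S.Q)) :
    S.famKet b' s = (S.inst b' (S.vOf (S.xyv s.1 s.2))).phi7d := rfl

/-- **Fourier sandwich over the tail offsets, matrix form** (the computation of (R) `sum_weight_fam_eq` for an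
arbitrary matrix `A` in place of a sum of effects): for fixed slopes (`b′_{t+1} = 2p₁B_t`) and head offset `x`,
`Σ_ȳ ⟨φ7.d(b′,v′+L(x,ȳ))|A|φ7.d(b′,v′+L(x,ȳ))⟩ = Q⁻ⁿ Σ_η ⟨T w_{η,−2(x+σ_B(η))}|A|T w_{η,−2(x+σ_B(η))}⟩`.
[cite: ChenQuantumLattice2024, §3.5.8 pp. 33–34; NielsenChuang2010, §2.2.6 p. 90] -/
theorem sum_sandwich_fam_eq (A : Matrix (Fin (S.n + 1) → ZMod S.M) (Fin (S.n + 1) → ZMod S.M) ℂ)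
    (B : Fin S.n → ℤ) {b' : Fin (S.n + 1) → ℤ}
    (hb0 : b' 0 = -1) (hbt : ∀ t : Fin S.n, b' t.succ = 2 * (S.p₁ : ℤ) * B t) (x : ZMod S.Q) :
    ∑ yb : Fin S.n → ZMod S.Q, star (S.famKet b' (x, yb)) ⬝ᵥ (A *ᵥ S.famKet b' (x, yb))
      = (1 / ((S.Q : ℕ) : ℂ) ^ S.n) * ∑ η : Fin S.n → ZMod S.Q,
          star (S.step8Map (S.wv η (-2 * (x + S.sig B η))))
            ⬝ᵥ (A *ᵥ S.step8Map (S.wv η (-2 * (x + S.sig B η)))) := by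
  classical
  set c : ℂ := 1 / ((S.Q : ℕ) : ℂ) ^ S.n with hcdef
  obtain ⟨a, ha⟩ : ∃ a : (Fin S.n → ZMod S.Q) → ℂ, ∀ η, a η = ZMod.stdAddChar
      (-(2 * ((S.p₁ : ℕ) : ZMod S.Q) * x * S.sig B η) - ((S.p₁ : ℕ) : ZMod S.Q) * x ^ 2) :=
    ⟨_, fun _ => rfl⟩
  have ha1 : ∀ η, (starRingEnd ℂ) (a η) * a η = 1 := fun η => by
    rw [ha]; exact conj_stdAddChar_mul_self _
  have hφ : ∀ (yb : Fin S.n → ZMod S.Q) (p : Fin (S.n + 1) → ZMod S.M),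
      S.famKet b' (x, yb) p
        = c * ∑ η : Fin S.n → ZMod S.Q, ZMod.stdAddChar (-(∑ t, η t * yb t))
            * (a η * S.step8Map (S.wv η (-2 * (x + S.sig B η))) p) := by
    intro yb p
    show (S.inst b' (S.vOf (S.xyv x yb))).phi7d p = _
    rw [phi7d_inst_eq_step8Map]
    rw [S.step8Map_linComb Finset.univ
        (fun η => c * ZMod.stdAddChar (-(∑ t, η t * yb t) - 2 * ((S.p₁ : ℕ) : ZMod S.Q) * x * S.sig B η
          - ((S.p₁ : ℕ) : ZMod S.Q) * x ^ 2))
        (fun η => S.wv η (-2 * (x + S.sig B η))) _ (fun z => by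
          rw [S.phi7_inst_expansion B hb0 hbt x yb z, Finset.mul_sum]
          exact Finset.sum_congr rfl fun η _ => by ring) p]
    rw [Finset.mul_sum]
    refine Finset.sum_congr rfl fun η _ => ?_
    have hsplit : ZMod.stdAddChar (-(∑ t, η t * yb t) - 2 * ((S.p₁ : ℕ) : ZMod S.Q) * x * S.sig B η
          - ((S.p₁ : ℕ) : ZMod S.Q) * x ^ 2)
        = ZMod.stdAddChar (-(∑ t, η t * yb t)) * a η := by
      rw [ha, ← AddChar.map_add_eq_mul]; congr 1; ring
    rw [hsplit]; ring
  have hsand := sum_quadForm_fourier A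
    (fun η p => a η * S.step8Map (S.wv η (-2 * (x + S.sig B η))) p) c
    (fun yb => S.famKet b' (x, yb)) hφ
  have hcc : (starRingEnd ℂ) c * c * (((S.Q : ℕ) : ℂ)) ^ S.n = c := by
    have hQ : ((S.Q : ℕ) : ℂ) ≠ 0 := by exact_mod_cast S.Q.ne_zero
    have hcr : (starRingEnd ℂ) c = c := by rw [hcdef]; simp
    rw [hcr, hcdef]
    field_simp
  rw [hsand, hcc]
  refine congrArg _ (Finset.sum_congr rfl fun η _ => ?_)
  exact sandwich_unimodular_mul A (ha1 η) _

/-- The head relabelling `x ↦ −2(x + σ)` is a bijection of `ℤ_Q` (`Q` odd). [folklore] -/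
theorem bijective_neg_two_mul_add (h : S.Admissible) (σ : ZMod S.Q) :
    Function.Bijective fun x : ZMod S.Q => -2 * (x + σ) := by
  have hs : Function.Surjective fun x : ZMod S.Q => -2 * (x + σ) := fun m => by
    obtain ⟨x, hx⟩ := S.exists_eq_neg_two_mul h m
    exact ⟨x - σ, by simp only [sub_add_cancel]; exact hx.symm⟩
  exact ⟨Finite.injective_iff_surjective.2 hs, hs⟩

/-- **Fourier sandwich over the WHOLE family** (head AND tail offsets): for every matrix `A` and every
admissible slope vector `b′`, `Σ_{x,ȳ} ⟨φ7.d(b′,v′+L(x,ȳ))|A|φ7.d(b′,v′+L(x,ȳ))⟩ = Q⁻ⁿ Σ_η Σ_m ⟨T w_{η,m}|A|T w_{η,m}⟩`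
— the right-hand side DOES NOT DEPEND ON THE SLOPES `b′` (the slopes only relabel `m = −2(x + σ_B(η))`,
a bijection of `ℤ_Q` for each `η`).  [cite: ChenQuantumLattice2024, §3.5.8 pp. 33–34; NielsenChuang2010, §2.2.6 p. 90] -/
theorem sum_sandwich_family_eq (h : S.Admissible)
    (A : Matrix (Fin (S.n + 1) → ZMod S.M) (Fin (S.n + 1) → ZMod S.M) ℂ)
    (B : Fin S.n → ℤ) {b' : Fin (S.n + 1) → ℤ}
    (hb0 : b' 0 = -1) (hbt : ∀ t : Fin S.n, b' t.succ = 2 * (S.p₁ : ℤ) * B t) :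
    ∑ s : ZMod S.Q × (Fin S.n → ZMod S.Q), star (S.famKet b' s) ⬝ᵥ (A *ᵥ S.famKet b' s)
      = (1 / ((S.Q : ℕ) : ℂ) ^ S.n) * ∑ η : Fin S.n → ZMod S.Q, ∑ m : ZMod S.Q,
          star (S.step8Map (S.wv η m)) ⬝ᵥ (A *ᵥ S.step8Map (S.wv η m)) := by
  rw [Fintype.sum_prod_type, Finset.sum_congr rfl fun x _ => S.sum_sandwich_fam_eq A B hb0 hbt x,
    ← Finset.mul_sum]
  refine congrArg _ (Finset.sum_comm.trans (Finset.sum_congr rfl fun η _ => ?_))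
  exact (S.bijective_neg_two_mul_add h (S.sig B η)).sum_comp
    (fun m => star (S.step8Map (S.wv η m)) ⬝ᵥ (A *ᵥ S.step8Map (S.wv η m)))

/-- **SLOPE BLINDNESS OF THE CLASS FAMILY (Gram form).**  The Gram kernel of the family
`{|φ7.d(b′, v′ + L·(x,ȳ))⟩ : x ∈ ℤ_Q, ȳ ∈ ℤ_Qⁿ}` — equivalently the operator `Σ_{x,ȳ} |φ7.d⟩⟨φ7.d|` — is
`Q⁻ⁿ Σ_η Σ_m conj(T w_{η,m}(z))·T w_{η,m}(z′)`, INDEPENDENT OF THE SLOPE VECTOR `b′`.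
[cite: ChenQuantumLattice2024, §3.5.8 pp. 33–34; NielsenChuang2010, §2.4.3 p. 107] -/
theorem gram_famKet_eq (h : S.Admissible) (B : Fin S.n → ℤ) {b' : Fin (S.n + 1) → ℤ}
    (hb0 : b' 0 = -1) (hbt : ∀ t : Fin S.n, b' t.succ = 2 * (S.p₁ : ℤ) * B t)
    (z z' : Fin (S.n + 1) → ZMod S.M) :
    ∑ s : ZMod S.Q × (Fin S.n → ZMod S.Q), star (S.famKet b' s z) * S.famKet b' s z'
      = (1 / ((S.Q : ℕ) : ℂ) ^ S.n) * ∑ η : Fin S.n → ZMod S.Q, ∑ m : ZMod S.Q,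
          star (S.step8Map (S.wv η m) z) * S.step8Map (S.wv η m) z' := by
  have h1 := S.sum_sandwich_family_eq h (Matrix.single z z' (1 : ℂ)) B hb0 hbt
  simpa only [star_dotProduct_single_mulVec] using h1

/-- Hence two admissible slope vectors give families with the SAME Gram kernel.
[cite: ChenQuantumLattice2024, §3.5.8 pp. 33–34; NielsenChuang2010, §2.4.3 p. 107] -/
theorem gram_famKet_slope_free (h : S.Admissible) (B₁ B₂ : Fin S.n → ℤ) {b₁ b₂ : Fin (S.n + 1) → ℤ}
    (h10 : b₁ 0 = -1) (h1t : ∀ t : Fin S.n, b₁ t.succ = 2 * (S.p₁ : ℤ) * B₁ t)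
    (h20 : b₂ 0 = -1) (h2t : ∀ t : Fin S.n, b₂ t.succ = 2 * (S.p₁ : ℤ) * B₂ t)
    (z z' : Fin (S.n + 1) → ZMod S.M) :
    ∑ s : ZMod S.Q × (Fin S.n → ZMod S.Q), star (S.famKet b₁ s z) * S.famKet b₁ s z'
      = ∑ s : ZMod S.Q × (Fin S.n → ZMod S.Q), star (S.famKet b₂ s z) * S.famKet b₂ s z' := by
  rw [S.gram_famKet_eq h B₁ h10 h1t, S.gram_famKet_eq h B₂ h20 h2t]

/-! ### The companion register: further runs on the same secret -/

/-- The offset vector `w + L·(x, ȳ)` of the family member `(x, ȳ)` over a base offset `w ∈ Dℤⁿ⁺¹`.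
[cite: ChenQuantumLattice2024, eq. (35) p. 31] -/
def compOffset (w : Fin (S.n + 1) → ℤ) (s : ZMod S.Q × (Fin S.n → ZMod S.Q)) : Fin (S.n + 1) → ℤ :=
  fun i => w i + S.L * S.xyv s.1 s.2 i

/-- The COMPANION STATES: run `k` (base offset `w_k`, its own unknown offset in `Dℤⁿ⁺¹`) with family parameter
`s = (x_k, ȳ_k)` and slope vector `b′` holds `|φ7.d(b′, w_k + L·(x_k, ȳ_k))⟩`.
[cite: ChenQuantumLattice2024, eq. (35) p. 31, §3.5.8 p. 33] -/
noncomputable def compFam {κ : Type*} (w : κ → Fin (S.n + 1) → ℤ) (b' : Fin (S.n + 1) → ℤ) (k : κ)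
    (s : ZMod S.Q × (Fin S.n → ZMod S.Q)) : (Fin (S.n + 1) → ZMod S.M) → ℂ :=
  (S.inst b' (S.compOffset (w k) s)).phi7d

/-- The COMPANION REGISTER of `r = #κ` further runs of Steps 1–8 on the SAME secret (same slopes `b′`),
each with its own base offset `w_k` and family parameter `t_k = (x_k, ȳ_k)`: the product state
`⊗_k |φ7.d(b′, w_k + L·t_k)⟩` on `(ℤ_M^{n+1})^κ`. [cite: ChenQuantumLattice2024, §3.5.8 p. 33; NielsenChuang2010, §2.1.7 p. 73] -/
noncomputable def compKet {κ : Type*} [Fintype κ] (w : κ → Fin (S.n + 1) → ℤ) (b' : Fin (S.n + 1) → ℤ)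
    (t : κ → ZMod S.Q × (Fin S.n → ZMod S.Q)) : (κ → Fin (S.n + 1) → ZMod S.M) → ℂ :=
  piKet fun k => S.compFam w b' k (t k)

/-- The companion family of run `k` IS the `(x, ȳ)`-family of the REBASED shape `S[v′ := w_k]` (same slopes,
same public data, offset `w_k`). [cite: ChenQuantumLattice2024, eq. (35) p. 31] -/
theorem compFam_eq_famKet {κ : Type*} (w : κ → Fin (S.n + 1) → ℤ) (b' : Fin (S.n + 1) → ℤ) (k : κ)
    (s : ZMod S.Q × (Fin S.n → ZMod S.Q)) :
    S.compFam w b' k s = (S.inst S.b (w k)).famKet b' s := rfl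

/-- Companion states are admissible instances (for admissible slopes and base offsets in `Dℤⁿ⁺¹`).
[cite: ChenQuantumLattice2024, Cond. C.3 p. 18, eq. (35) p. 31] -/
theorem compOffset_admissible (h : S.Admissible) {b' : Fin (S.n + 1) → ℤ} (hb0 : b' 0 = -1)
    (hbt : ∀ i, i ≠ 0 → (2 * (S.p₁ : ℤ)) ∣ b' i) {w : Fin (S.n + 1) → ℤ} (hw : ∀ i, (S.D : ℤ) ∣ w i)
    (s : ZMod S.Q × (Fin S.n → ZMod S.Q)) : (S.inst b' (S.compOffset w s)).Admissible :=
  S.inst_admissible h hb0 hbt fun i => dvd_add (hw i) (dvd_mul_of_dvd_left S.D_dvd_L _)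

/-- `⟨companion register|companion register⟩ = ν₇^r`. [cite: NielsenChuang2010, §2.1.7 p. 73] -/
theorem star_compKet_dotProduct_compKet (h : S.Admissible) {κ : Type*} [Fintype κ] [DecidableEq κ]
    {w : κ → Fin (S.n + 1) → ℤ} (hw : ∀ k i, (S.D : ℤ) ∣ w k i) {b' : Fin (S.n + 1) → ℤ}
    (hb0 : b' 0 = -1) (hbt : ∀ i, i ≠ 0 → (2 * (S.p₁ : ℤ)) ∣ b' i)
    (t : κ → ZMod S.Q × (Fin S.n → ZMod S.Q)) :
    star (S.compKet w b' t) ⬝ᵥ S.compKet w b' t = ((S.normSq7d ^ Fintype.card κ : ℝ) : ℂ) := by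
  have hk : ∀ k, star (S.compFam w b' k (t k)) ⬝ᵥ S.compFam w b' k (t k) = (S.normSq7d : ℂ) := fun k =>
    S.star_phi7d_dotProduct_phi7d_inst_ofReal (S.compOffset_admissible h hb0 hbt (hw k) (t k))
  rw [compKet, star_piKet_dotProduct_piKet, Finset.prod_congr rfl fun k _ => hk k, Finset.prod_const,
    Finset.card_univ, Complex.ofReal_pow]

/-- **SLOPE BLINDNESS OF THE COMPANION REGISTER:** averaged over the companions' family parameters
`t ∈ (ℤ_Q × ℤ_Qⁿ)^κ`, the companion register `⊗_k |φ7.d(b′, w_k + L·t_k)⟩` has the same Gram kernel — i.e. is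
the same (unnormalised) mixed state — for EVERY admissible slope vector `b′`: the companions carry no
information about the slopes. [cite: ChenQuantumLattice2024, §3.5.8 pp. 33–34; NielsenChuang2010, §2.4.3 p. 107] -/
theorem gram_compKet_slope_free (h : S.Admissible) {κ : Type*} [Fintype κ] [DecidableEq κ]
    {w : κ → Fin (S.n + 1) → ℤ} (hw : ∀ k i, (S.D : ℤ) ∣ w k i) (B₁ B₂ : Fin S.n → ℤ)
    {b₁ b₂ : Fin (S.n + 1) → ℤ}
    (h10 : b₁ 0 = -1) (h1t : ∀ t : Fin S.n, b₁ t.succ = 2 * (S.p₁ : ℤ) * B₁ t)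
    (h20 : b₂ 0 = -1) (h2t : ∀ t : Fin S.n, b₂ t.succ = 2 * (S.p₁ : ℤ) * B₂ t)
    (y y' : κ → Fin (S.n + 1) → ZMod S.M) :
    ∑ t : κ → ZMod S.Q × (Fin S.n → ZMod S.Q), star (S.compKet w b₁ t y) * S.compKet w b₁ t y'
      = ∑ t : κ → ZMod S.Q × (Fin S.n → ZMod S.Q), star (S.compKet w b₂ t y) * S.compKet w b₂ t y' := by
  unfold compKet
  rw [gram_piKet (S.compFam w b₁), gram_piKet (S.compFam w b₂)]
  refine Finset.prod_congr rfl fun k _ => ?_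
  simp only [compFam_eq_famKet]
  exact (S.inst S.b (w k)).gram_famKet_slope_free (S.inst_admissible h h.b_head h.b_tail (hw k))
    B₁ B₂ h10 h1t h20 h2t (y k) (y' k)

/-! ### THE SEVERAL-COPIES READ-OUT VALUE -/

/-- **READ-OUT BOUND WITH COMPANION COPIES (upper side of (σ″)).**  Let ANY joint general measurement `E`
(any outcome type) of the Step-8 register TOGETHER WITH a companion register of `r = #κ` further runs on the
same secret — companion `k` in the state `|φ7.d(b, w_k + L·t_k)⟩` of its own unknown offset (base `w_k ∈ Dℤⁿ⁺¹`,
family parameter `t_k ∈ ℤ_Q × ℤ_Qⁿ`), all runs sharing the secret's slope vector `b` — be followed by ANY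
decoder `dec` for the reference run's Step-9 datum `v′₀ mod D²P`.  Then for some instance `(b₂, v₂)` of the
class `InClass U` and some companion parameters `t` (every companion then also an instance of `InClass U` with
slopes `b₂`) the success weight is at most `pairsCountT(Q,T)/Q^{2n}·⟨Ψ|Ψ⟩`, `Ψ` the joint (product) state —
the SAME constant as for one copy ((S) `step9Needs_readout_le_dummies`).  Proof: average the companions out
(`POVM.envAverage`, an effective single-register POVM) and apply (S); by SLOPE BLINDNESS
(`gram_compKet_slope_free`) the averaged companion register is the same state for the witness slopes `b₂` as for
the reference slopes, so the bound transfers, and some companion tuple does no better than the average.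
A theorem about a WITHDRAWN algorithm's Step 8/9 interface; nothing about LWE.
[cite: ChenQuantumLattice2024, §3.5.8 pp. 33–34, §3.5.9 p. 37; NielsenChuang2010, §2.2.6 p. 90, §2.4.3 p. 107] -/
theorem step9Needs_readout_le_joint (h : S.Admissible) (T : Finset (Fin S.n))
    {U : Finset (Fin (S.n + 1))} (hU : ∀ t ∈ T, t.succ ∈ U)
    {κ : Type*} [Fintype κ] [DecidableEq κ] {w : κ → Fin (S.n + 1) → ℤ} (hw : ∀ k i, (S.D : ℤ) ∣ w k i)
    {A : Type*} [Fintype A] [DecidableEq A]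
    (E : POVM ((Fin (S.n + 1) → ZMod S.M) × (κ → Fin (S.n + 1) → ZMod S.M)) A) (dec : A → ZMod S.N) :
    ∃ (b₂ v₂ : Fin (S.n + 1) → ℤ) (t : κ → ZMod S.Q × (Fin S.n → ZMod S.Q)),
      S.InClass U b₂ v₂ ∧ (∀ k, S.InClass U b₂ (S.compOffset (w k) (t k))) ∧
      (∑ a ∈ Finset.univ.filter (fun a => dec a = (S.inst b₂ v₂).step9Needs),
          (E.weight (tensorKet (S.inst b₂ v₂).phi7d (S.compKet w b₂ t)) a).re)
        ≤ (pairsCountT (S.Q : ℕ) T : ℝ) / ((S.Q : ℕ) : ℝ) ^ (2 * S.n)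
            * (star (tensorKet (S.inst b₂ v₂).phi7d (S.compKet w b₂ t))
                ⬝ᵥ tensorKet (S.inst b₂ v₂).phi7d (S.compKet w b₂ t)).re := by
  classical
  have hνpos : 0 < S.normSq7d ^ Fintype.card κ := pow_pos S.normSq7d_pos _
  -- Stage 1: the single-copy bound (S) for the effective measurement "average the companions out",
  -- the companions taken with the TRUE slope vector `b`
  obtain ⟨b₂, v₂, hI, hle⟩ := S.step9Needs_readout_le_dummies h T hU
    (E.envAverage (S.compKet w S.b) _ hνpos (S.star_compKet_dotProduct_compKet h hw h.b_head h.b_tail)) dec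
  have hb0 : b₂ 0 = -1 := hI.2.b_head
  have hbt : ∀ i, i ≠ 0 → (2 * (S.p₁ : ℤ)) ∣ b₂ i := hI.2.b_tail
  obtain ⟨B₁, hB₁⟩ : ∃ B : Fin S.n → ℤ, ∀ t : Fin S.n, S.b t.succ = 2 * (S.p₁ : ℤ) * B t :=
    ⟨fun t => S.b t.succ / (2 * (S.p₁ : ℤ)),
      fun t => (Int.mul_ediv_cancel' (h.b_tail t.succ (Fin.succ_ne_zero t))).symm⟩
  obtain ⟨B₂, hB₂⟩ : ∃ B : Fin S.n → ℤ, ∀ t : Fin S.n, b₂ t.succ = 2 * (S.p₁ : ℤ) * B t :=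
    ⟨fun t => b₂ t.succ / (2 * (S.p₁ : ℤ)),
      fun t => (Int.mul_ediv_cancel' (hbt t.succ (Fin.succ_ne_zero t))).symm⟩
  -- Stage 2: slope blindness — the companions with slopes `b₂` give the same summed joint weights
  set ψ := (S.inst b₂ v₂).phi7d with hψ
  set F := Finset.univ.filter (fun a => dec a = (S.inst b₂ v₂).step9Needs) with hF
  rw [POVM.sum_envAverage_weight_re] at hle
  have hswap : ∀ Φ : (κ → ZMod S.Q × (Fin S.n → ZMod S.Q)) → (κ → Fin (S.n + 1) → ZMod S.M) → ℂ,
      ∑ t, ∑ a ∈ F, (E.weight (tensorKet ψ (Φ t)) a).re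
        = ∑ a ∈ F, (∑ t, E.weight (tensorKet ψ (Φ t)) a).re := by
    intro Φ
    rw [Finset.sum_comm]
    simp only [Complex.re_sum]
  have hEq : ∑ t, ∑ a ∈ F, (E.weight (tensorKet ψ (S.compKet w S.b t)) a).re
      = ∑ t, ∑ a ∈ F, (E.weight (tensorKet ψ (S.compKet w b₂ t)) a).re := by
    rw [hswap, hswap]
    exact Finset.sum_congr rfl fun a _ => by
      rw [E.sum_weight_tensorKet_eq_of_gram_eq _ _
        (S.gram_compKet_slope_free h hw B₁ B₂ h.b_head hB₁ hb0 hB₂) ψ a]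
  rw [hEq] at hle
  -- Stage 3: some companion tuple does no better than the average
  have hsum : ∑ t, ∑ a ∈ F, (E.weight (tensorKet ψ (S.compKet w b₂ t)) a).re
      ≤ ∑ _t : κ → ZMod S.Q × (Fin S.n → ZMod S.Q),
          (pairsCountT (S.Q : ℕ) T : ℝ) / ((S.Q : ℕ) : ℝ) ^ (2 * S.n) * (star ψ ⬝ᵥ ψ).re
            * S.normSq7d ^ Fintype.card κ := by
    rw [Finset.sum_const, Finset.card_univ, nsmul_eq_mul]
    have hcard : (0 : ℝ) < (Fintype.card (κ → ZMod S.Q × (Fin S.n → ZMod S.Q)) : ℝ)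
        * S.normSq7d ^ Fintype.card κ :=
      mul_pos (Nat.cast_pos.2 Fintype.card_pos) hνpos
    have h1 := (inv_mul_le_iff₀ hcard).1 hle
    calc _ ≤ _ := h1
      _ = _ := by ring
  obtain ⟨t, -, ht⟩ := Finset.exists_le_of_sum_le Finset.univ_nonempty hsum
  refine ⟨b₂, v₂, t, hI, fun k => ⟨hI.1, S.compOffset_admissible h hb0 hbt (hw k) (t k)⟩, ?_⟩
  rw [star_tensorKet_dotProduct_tensorKet, S.star_compKet_dotProduct_compKet h hw hb0 hbt,
    Complex.re_mul_ofReal]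
  exact ht.trans_eq (mul_assoc _ _ _)

/-- **… AND IT IS ATTAINED, companions or not (lower side of (σ″)):** the class measurement of (U) on the
reference register, trivially extended to the companion register (`classPOVM ⊗ 1`, ignore the companions —
indeed ignore ANY environment state `Φ`), with the decoder `classDec T`, succeeds on EVERY instance of
`InClass U` with weight EXACTLY `pairsCountT(Q,T)/Q^{2n}·⟨φ7.d ⊗ Φ|φ7.d ⊗ Φ⟩`.
[cite: ChenQuantumLattice2024, §3.5.8 pp. 33–34; NielsenChuang2010, §2.2.6 p. 90, §2.1.7 p. 74] -/
theorem step9Needs_readout_attained_joint (h : S.Admissible) {U : Finset (Fin (S.n + 1))}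
    {T : Finset (Fin S.n)} (hT : ∀ t : Fin S.n, t.succ ∈ U → t ∈ T) {b₂ v₂ : Fin (S.n + 1) → ℤ}
    (hI : S.InClass U b₂ v₂) {Y : Type*} [Fintype Y] [DecidableEq Y] (Φ : Y → ℂ) :
    ∑ a ∈ Finset.univ.filter (fun a => S.classDec T a = (S.inst b₂ v₂).step9Needs),
        (((S.classPOVM h).tensorOne Y).weight (tensorKet (S.inst b₂ v₂).phi7d Φ) a).re
      = (pairsCountT (S.Q : ℕ) T : ℝ) / ((S.Q : ℕ) : ℝ) ^ (2 * S.n)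
          * (star (tensorKet (S.inst b₂ v₂).phi7d Φ) ⬝ᵥ tensorKet (S.inst b₂ v₂).phi7d Φ).re := by
  simp only [POVM.tensorOne_weight]
  rw [star_tensorKet_dotProduct_tensorKet, star_dotProduct_self_ofReal Φ]
  simp only [Complex.re_mul_ofReal]
  rw [← Finset.sum_mul, S.step9Needs_readout_attained_class h hT hI, mul_assoc]

/-- **THE VALUE OF THE SEVERAL-COPIES READ-OUT PROBLEM = THE SINGLE-COPY VALUE (both sides, packaged; answers
(σ″) of the bundle's HANDOFF).**  For every set `U` of unknown slope coordinates (`T_U = {t : t+1 ∈ U}`) and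
every companion register of `r = #κ` further runs on the same secret (base offsets `w_k ∈ Dℤⁿ⁺¹`):
(i) for EVERY joint measurement `E` of reference + companions and EVERY decoder, some instance of `InClass U`
with some companion parameters (all companions in `InClass U` too) has success weight
`≤ pairsCountT(Q,T_U)/Q^{2n}·⟨Ψ|Ψ⟩`; (ii) the single-register class measurement of (U), ignoring the
companions, succeeds on EVERY instance and EVERY companion tuple with weight EXACTLY that.  So the minimax
value of reading the Step-9 datum `v′₀ mod D²P` is `pairsCountT(Q,T_U)/Q^{2n}` FOR EVERY NUMBER `r` OF
COMPANION COPIES — it does not decay in `r`: extra runs sharing the slopes are useless for this datum, because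
averaged over their own unknown offsets they are slope-blind (`gram_compKet_slope_free`).  (The bound is on
the REFERENCE run's datum; reading out the whole tuple of data is only harder.)  A theorem about a WITHDRAWN
algorithm's Step 8/9 interface; no numerics; nothing about LWE.
[cite: ChenQuantumLattice2024, §3.5.8 pp. 33–34, §3.5.9 p. 37; NielsenChuang2010, §2.2.6 p. 90, §2.4.3 p. 107] -/
theorem step9Needs_readout_value_joint (h : S.Admissible) (U : Finset (Fin (S.n + 1)))
    {κ : Type*} [Fintype κ] [DecidableEq κ] {w : κ → Fin (S.n + 1) → ℤ} (hw : ∀ k i, (S.D : ℤ) ∣ w k i) :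
    (∀ {A : Type*} [Fintype A] [DecidableEq A]
        (E : POVM ((Fin (S.n + 1) → ZMod S.M) × (κ → Fin (S.n + 1) → ZMod S.M)) A) (dec : A → ZMod S.N),
      ∃ (b₂ v₂ : Fin (S.n + 1) → ℤ) (t : κ → ZMod S.Q × (Fin S.n → ZMod S.Q)),
        S.InClass U b₂ v₂ ∧ (∀ k, S.InClass U b₂ (S.compOffset (w k) (t k))) ∧
        (∑ a ∈ Finset.univ.filter (fun a => dec a = (S.inst b₂ v₂).step9Needs),
            (E.weight (tensorKet (S.inst b₂ v₂).phi7d (S.compKet w b₂ t)) a).re)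
          ≤ (pairsCountT (S.Q : ℕ) (S.tailSet U) : ℝ) / ((S.Q : ℕ) : ℝ) ^ (2 * S.n)
              * (star (tensorKet (S.inst b₂ v₂).phi7d (S.compKet w b₂ t))
                  ⬝ᵥ tensorKet (S.inst b₂ v₂).phi7d (S.compKet w b₂ t)).re) ∧
    (∀ (b₂ v₂ : Fin (S.n + 1) → ℤ) (t : κ → ZMod S.Q × (Fin S.n → ZMod S.Q)), S.InClass U b₂ v₂ →
      ∑ a ∈ Finset.univ.filter (fun a => S.classDec (S.tailSet U) a = (S.inst b₂ v₂).step9Needs),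
          (((S.classPOVM h).tensorOne (κ → Fin (S.n + 1) → ZMod S.M)).weight
              (tensorKet (S.inst b₂ v₂).phi7d (S.compKet w b₂ t)) a).re
        = (pairsCountT (S.Q : ℕ) (S.tailSet U) : ℝ) / ((S.Q : ℕ) : ℝ) ^ (2 * S.n)
            * (star (tensorKet (S.inst b₂ v₂).phi7d (S.compKet w b₂ t))
                ⬝ᵥ tensorKet (S.inst b₂ v₂).phi7d (S.compKet w b₂ t)).re) :=
  ⟨fun E dec => S.step9Needs_readout_le_joint h (S.tailSet U) (fun t ht => (S.mem_tailSet U t).1 ht) hw E dec,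
    fun _ _ _ hI => S.step9Needs_readout_attained_joint h (fun t' ht => (S.mem_tailSet U t').2 ht) hI _⟩

end Shape

end Literature.Computability.Cryptography.Chen2024
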